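import Summits.QuantumAdvantage.QuantumAdvantage.Theorems.CodimDialFewA

/-! # CodimDialFew — part 2/2 (mechanical split for landing of `CodimDialFew`; content verbatim; scopes re-opened with their variables) -/

set_option linter.style.longLine false
set_option linter.dupNamespace false
noncomputable section
open scoped Classical

namespace Summit.QuantumAdvantage.QuantumAdvantage.Theorems.CodimDial
open Finset
open Literature.Computability.QuantumComplexity Literature.Computability.QuantumComplexity.RingHLF
open Literature.Computability.MetaComplexity
open Summit.QuantumAdvantage.AdviceFreeQNC0
open Summit.QuantumAdvantage.QuantumAdvantage.Theses

section Few
variable {n : ℕ}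

/-! ### medium ⟹ pool: collapse + block compression -/

/-- **medium ⟹ small pools**: `LinSpreadLogMed3 → LinSpreadPool3`.  Collapse the given system to `ℓ = k(log₂ n+1)+1`
combined rows (weight `≤ N ≤ n(log₂ n)^a`), compress each with blocks of size `8(log₂ n)^a` into a row of weight
`≤ n/8 + 1 ≤ n/4` on the block-function pool (degree `≤ (log₂ n)^(a+c+4)`), apply the medium statement, subtract
the leak. -/
theorem linSpreadPool3_of_linSpreadLogMed3 (h : LinSpreadLogMed3) : LinSpreadPool3 := by
  obtain ⟨η, hη, k, hk⟩ := h
  refine ⟨η, hη, k + 1, fun a c => ?_⟩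
  obtain ⟨n₀, hn₀⟩ := hk (2 * k + 2) (a + c + 4)
  refine ⟨max n₀ 8, fun n hn P hP N hN G hG M A b hdense => ?_⟩
  have hnn₀ : n₀ ≤ n := le_of_max_le_left hn
  have hn8 : 8 ≤ n := le_of_max_le_right hn
  have hn2 : 2 ≤ n := by omega
  have hL3 : 3 ≤ Nat.log 2 n := Nat.le_log_of_pow_le (by norm_num) (by norm_num; omega)
  have hL1 : 1 ≤ Nat.log 2 n := by omega
  obtain ⟨h2ℓ, hℓC⟩ := collapse_exponent (k := k) hn2
  set ℓ := k * (Nat.log 2 n + 1) + 1 with hℓ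
  -- collapse
  obtain ⟨R, hR⟩ := exists_reduction (X := Fin n → Bool) (fun y j => defect G (A j) (b j) y) ℓ
  let A₁ : Fin ℓ → Fin N → ZMod 2 := fun r u => ∑ j, R r j * A j u
  let b₁ : Fin ℓ → ZMod 2 := fun r => ∑ j, R r j * b j
  have hdef : ∀ r y, defect G (A₁ r) (b₁ r) y = ∑ j, R r j * defect G (A j) (b j) y :=
    fun r y => defect_combine G A b R r y
  have hsub : linEvent G A b ⊆ linEvent G A₁ b₁ := by
    intro y hy
    simp only [linEvent, mem_filter, mem_univ, true_and] at hy ⊢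
    intro r
    rw [hdef]
    exact Finset.sum_eq_zero fun j _ => by rw [hy j, mul_zero]
  -- compression with blocks of size `8 (log₂ n)^a`
  have hB : 0 < 8 * (Nat.log 2 n) ^ a := by positivity
  obtain ⟨G', A', hG', hW', hE'⟩ := compress hB G hG A₁ b₁
  have hdiv : N / (8 * (Nat.log 2 n) ^ a) ≤ n / 8 := by
    calc N / (8 * (Nat.log 2 n) ^ a) ≤ (n * (Nat.log 2 n) ^ a) / (8 * (Nat.log 2 n) ^ a) := Nat.div_le_div_right hN
      _ = n / 8 := Nat.mul_div_mul_right (n := n) (k := 8) (by positivity)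
  have hJ : 4 * (N / (8 * (Nat.log 2 n) ^ a) + 1) ≤ n := by omega
  have hW'' : ∀ r, 4 * rowWeight (A' r) ≤ n := fun r => le_trans (Nat.mul_le_mul_left 4 (hW' r)) hJ
  have hℓn : ℓ ≤ n ^ (2 * k + 1) := le_trans (Nat.lt_two_pow_self).le hℓC
  have hJn : N / (8 * (Nat.log 2 n) ^ a) + 1 ≤ n := by omega
  have hN' : ℓ * (N / (8 * (Nat.log 2 n) ^ a) + 1) ≤ n ^ (2 * k + 2) := by
    calc ℓ * (N / (8 * (Nat.log 2 n) ^ a) + 1) ≤ n ^ (2 * k + 1) * n := Nat.mul_le_mul hℓn hJn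
      _ = n ^ (2 * k + 2) := by rw [← pow_succ]
  have hℓC' : 2 ^ ℓ ≤ n ^ (2 * k + 2) := le_trans hℓC (Nat.pow_le_pow_right (by omega) (by omega))
  -- degrees
  have hdegP : ∀ i, P i ∈ Smolensky.lowDeg (ZMod 3) n ((Nat.log 2 n) ^ (a + c + 4)) :=
    fun i => Smolensky.lowDeg_mono (Nat.pow_le_pow_right hL1 (by omega)) (hP i)
  have hdeg : 8 * (Nat.log 2 n) ^ a * ((Nat.log 2 n) ^ c + (Nat.log 2 n) ^ c) ≤ (Nat.log 2 n) ^ (a + c + 4) := by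
    have h16 : 16 ≤ (Nat.log 2 n) ^ 4 :=
      calc 16 = 2 ^ 4 := by norm_num
        _ ≤ (Nat.log 2 n) ^ 4 := Nat.pow_le_pow_left (by omega) 4
    calc 8 * (Nat.log 2 n) ^ a * ((Nat.log 2 n) ^ c + (Nat.log 2 n) ^ c)
        = 16 * ((Nat.log 2 n) ^ a * (Nat.log 2 n) ^ c) := by ring
      _ ≤ (Nat.log 2 n) ^ 4 * ((Nat.log 2 n) ^ a * (Nat.log 2 n) ^ c) := Nat.mul_le_mul_right _ h16
      _ = (Nat.log 2 n) ^ (a + c + 4) := by rw [← pow_add, ← pow_add]; congr 1; omega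
  have hG'' : ∀ u', G' u' ∈ Smolensky.lowDeg (ZMod 3) n ((Nat.log 2 n) ^ (a + c + 4)) :=
    fun u' => Smolensky.lowDeg_mono hdeg (hG' u')
  -- apply the medium statement to the compressed combined system
  have hdense' : (1 - η) * (2 : ℝ) ^ n ≤ ((linEvent G' A' b₁).card : ℝ) := by
    rw [hE']
    exact le_trans hdense (by exact_mod_cast card_le_card hsub)
  have hmain := hn₀ n hnn₀ P hdegP (ℓ * (N / (8 * (Nat.log 2 n) ^ a) + 1)) hN' G' hG'' ℓ hℓC' A' b₁ hW'' hdense'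
  rw [hE'] at hmain
  -- the leak
  let Bad : Finset (Fin n → Bool) :=
    univ.filter fun y => (∀ r, (∑ j, R r j * defect G (A j) (b j) y) = 0) ∧ ¬ ∀ j, defect G (A j) (b j) y = 0
  have hBad : Bad.card * 2 ^ ℓ ≤ 2 ^ n := by
    have := hR
    simpa [Bad, Fintype.card_fun, Fintype.card_bool, Fintype.card_fin] using this
  have hcover : linEvent G A₁ b₁ ∩ lossSet P ⊆ (linEvent G A b ∩ lossSet P) ∪ Bad := by
    intro y hy
    rw [Finset.mem_inter] at hy
    obtain ⟨hyE', hyL⟩ := hy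
    by_cases hyE : y ∈ linEvent G A b
    · exact Finset.mem_union_left _ (Finset.mem_inter.mpr ⟨hyE, hyL⟩)
    · refine Finset.mem_union_right _ ?_
      simp only [linEvent, mem_filter, mem_univ, true_and] at hyE' hyE
      simp only [Bad, mem_filter, mem_univ, true_and]
      exact ⟨fun r => by rw [← hdef]; exact hyE' r, hyE⟩
  exact leak_step hn2 h2ℓ hcover hBad hmain

/-! ### pool ⟹ few: the embedding on the pool `m·n` -/

/-- **small pools ⟹ few rings**: `LinSpreadPool3 → SpreadLossFew3` (§5 with the pool `m·n ≤ n(log₂ n)^a`). -/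
theorem spreadLossFew3_of_linSpreadPool3 (h : LinSpreadPool3) : SpreadLossFew3 := by
  obtain ⟨η, hη, k, hk⟩ := h
  refine ⟨η, hη, k, fun a c => ?_⟩
  obtain ⟨n₀, hn₀⟩ := hk a c
  refine ⟨n₀, fun n hn P hP m hm w Q hQ hdense => ?_⟩
  have hG : ∀ u, flatQ Q u ∈ Smolensky.lowDeg (ZMod 3) n ((Nat.log 2 n) ^ c) := fun u => hQ _ _
  have hN : m * n ≤ n * (Nat.log 2 n) ^ a := by rw [mul_comm]; exact Nat.mul_le_mul_left n hm
  have hcardB : Fintype.card (Fin n → Bool) = 2 ^ n := by simp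
  let eB : (Fin n → Bool) ≃ Fin (2 ^ n) := Fintype.equivFinOfCardEq hcardB
  let eJ : Fin m × (Fin n → Bool) ≃ Fin (m * 2 ^ n) :=
    (Equiv.prodCongr (Equiv.refl (Fin m)) eB).trans finProdFinEquiv
  let A : Fin (m * 2 ^ n) → Fin (m * n) → ZMod 2 := fun r =>
    if InKernel (w (eJ.symm r).1) (eJ.symm r).2 then ringRow (eJ.symm r).1 (eJ.symm r).2 else 0
  let b : Fin (m * 2 ^ n) → ZMod 2 := fun r =>
    if InKernel (w (eJ.symm r).1) (eJ.symm r).2 then ((signBit (w (eJ.symm r).1) (eJ.symm r).2 : ℕ) : ZMod 2) else 0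
  have hrow : ∀ (t : Fin m) (v : Fin n → Bool) (y : Fin n → Bool),
      defect (flatQ Q) (A (eJ (t, v))) (b (eJ (t, v))) y = 0 ↔
        (InKernel (w t) v → dot2 v (fun i => decide (Q t i y = 1)) = signBit (w t) v) := by
    intro t v y
    by_cases hK : InKernel (w t) v
    · simp only [A, b, Equiv.symm_apply_apply, hK, if_true, forall_true_left]
      rw [defect_ringRow, parity_iff]
    · simp only [A, b, Equiv.symm_apply_apply, hK, if_false, IsEmpty.forall_iff, iff_true]
      exact defect_zero _ y
  have hkey : ∀ y : Fin n → Bool, (∀ r, defect (flatQ Q) (A r) (b r) y = 0) ↔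
      ∀ t, RingHLF.Rel (w t) (fun i => decide (Q t i y = 1)) := by
    intro y
    constructor
    · intro hall t v hv
      exact (hrow t v y).mp (hall (eJ (t, v))) hv
    · intro hrel r
      have := (hrow (eJ.symm r).1 (eJ.symm r).2 y).mpr (hrel _ _)
      simpa only [Prod.mk.eta, Equiv.apply_symm_apply] using this
  have hdense' : (1 - η) * (2 : ℝ) ^ n ≤ ((linEvent (flatQ Q) A b).card : ℝ) := by
    refine le_trans hdense ?_
    exact_mod_cast card_le_card fun y hy => by
      simp only [Finset.mem_filter, Finset.mem_univ, true_and] at hy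
      simp only [linEvent, Finset.mem_filter, Finset.mem_univ, true_and]
      exact (hkey y).mpr hy
  have hmain := hn₀ n hn P hP (m * n) hN (flatQ Q) hG (m * 2 ^ n) A b hdense'
  refine le_trans hmain ?_
  exact_mod_cast card_le_card fun y hy => by
    rw [Finset.mem_inter] at hy
    simp only [linEvent, lossSet, Finset.mem_filter, Finset.mem_univ, true_and] at hy
    simp only [Finset.mem_filter, Finset.mem_univ, true_and]
    exact ⟨(hkey y).mp hy.1, hy.2⟩

/-! ### few ⟹ medium: the host construction with `m = ℓ ≤ (log₂ n)²` rings -/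

/-- at logarithmic codimension the number of rows is `≤ (log₂ n)²` (once `log₂ n ≥ 4C + 4`). [arithmetic] -/
theorem rows_le_sq {C ℓ : ℕ} (hL : 4 * C + 4 ≤ Nat.log 2 n) (hℓ : 2 ^ ℓ ≤ n ^ C) : ℓ ≤ (Nat.log 2 n) ^ 2 := by
  set L := Nat.log 2 n with hLdef
  have h1 : n < 2 ^ (L + 1) := Nat.lt_pow_succ_log_self (by norm_num) n
  have hℓL : ℓ ≤ C * (L + 1) := by
    have : 2 ^ ℓ ≤ 2 ^ (C * (L + 1)) :=
      calc 2 ^ ℓ ≤ n ^ C := hℓ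
        _ ≤ (2 ^ (L + 1)) ^ C := Nat.pow_le_pow_left h1.le C
        _ = 2 ^ (C * (L + 1)) := by rw [← pow_mul, mul_comm]
    exact (Nat.pow_le_pow_iff_right (by norm_num)).mp this
  calc ℓ ≤ C * (L + 1) := hℓL
    _ ≤ L * L := by nlinarith
    _ = L ^ 2 := (sq L).symm

/-- **few rings ⟹ medium**: `SpreadLossFew3 → LinSpreadLogMed3` (the host rings of §9–§10, `ℓ ≤ (log₂ n)²` of them). -/
theorem linSpreadLogMed3_of_spreadLossFew3 (h : SpreadLossFew3) : LinSpreadLogMed3 := by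
  obtain ⟨η, hη, k, hk⟩ := h
  refine ⟨η, hη, k, fun C c => ?_⟩
  obtain ⟨n₀, hn₀⟩ := hk 2 c
  refine ⟨max n₀ (2 ^ (4 * C + 4)), fun n hn P hP N hN G hG ℓ hℓ A b hW hdense => ?_⟩
  have hnn₀ : n₀ ≤ n := le_of_max_le_left hn
  have hnpow : 2 ^ (4 * C + 4) ≤ n := le_of_max_le_right hn
  have hn4 : 4 ≤ n := le_trans (by
    calc 4 = 2 ^ 2 := by norm_num
      _ ≤ 2 ^ (4 * C + 4) := Nat.pow_le_pow_right (by norm_num) (by omega)) hnpow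
  have hL : 4 * C + 4 ≤ Nat.log 2 n := Nat.le_log_of_pow_le (by norm_num) hnpow
  have hℓsq : ℓ ≤ (Nat.log 2 n) ^ 2 := rows_le_sq hL hℓ
  have hWr : ∀ r, 2 * (rowSupp (A r)).card + 1 < n := by
    intro r
    have := hW r
    show 2 * rowWeight (A r) + 1 < n
    omega
  let Q : Fin ℓ → Fin n → Smolensky.CubeFn (ZMod 3) n := fun r => hostQ G (A r) (b r)
  have hQ : ∀ r s, Q r s ∈ Smolensky.lowDeg (ZMod 3) n ((Nat.log 2 n) ^ c) :=
    fun r s => hostQ_mem_lowDeg G hG (A r) (b r) s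
  have hkey : ∀ y, (∀ r, RingHLF.Rel (zeroIn n) (fun s => decide (Q r s y = 1))) ↔ y ∈ linEvent G A b := by
    intro y
    simp only [linEvent, Finset.mem_filter, Finset.mem_univ, true_and]
    exact forall_congr' fun r => host_rel_iff (by omega) G (A r) (b r) (hWr r) y
  have hdense' : (1 - η) * (2 : ℝ) ^ n ≤ ((univ.filter fun y : Fin n → Bool =>
      ∀ r, RingHLF.Rel ((fun _ => zeroIn n : Fin ℓ → Fin n → Bool) r) (fun s => decide (Q r s y = 1))).card : ℝ) := by
    refine le_trans hdense ?_
    exact_mod_cast card_le_card fun y hy => by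
      simp only [Finset.mem_filter, Finset.mem_univ, true_and]
      exact (hkey y).mpr hy
  have hmain := hn₀ n hnn₀ P hP ℓ hℓsq (fun _ => zeroIn n) Q hQ hdense'
  refine le_trans hmain ?_
  exact_mod_cast card_le_card fun y hy => by
    simp only [Finset.mem_filter, Finset.mem_univ, true_and] at hy
    rw [Finset.mem_inter]
    refine ⟨(hkey y).mp hy.1, ?_⟩
    simp only [lossSet, Finset.mem_filter, Finset.mem_univ, true_and]
    exact hy.2

/-! ### The equivalences and the `m`-axis split -/

/-- CodimDialFew helper `spreadLossFew3_of_linSpreadLogMed3` (decomp-qadv land package; see the module docstring). -/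
theorem spreadLossFew3_of_linSpreadLogMed3 (h : LinSpreadLogMed3) : SpreadLossFew3 :=
  spreadLossFew3_of_linSpreadPool3 (linSpreadPool3_of_linSpreadLogMed3 h)

/-- ★ few rings ⟺ medium systems. -/
theorem linSpreadLogMed3_iff_spreadLossFew3 : LinSpreadLogMed3 ↔ SpreadLossFew3 :=
  ⟨spreadLossFew3_of_linSpreadLogMed3, linSpreadLogMed3_of_spreadLossFew3⟩

/-- ★ small pools ⟺ few rings. -/
theorem linSpreadPool3_iff_spreadLossFew3 : LinSpreadPool3 ↔ SpreadLossFew3 :=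
  ⟨spreadLossFew3_of_linSpreadPool3, fun h => linSpreadPool3_of_linSpreadLogMed3 (linSpreadLogMed3_of_spreadLossFew3 h)⟩

/-- down the `m`-axis: `SpreadLoss3 → SpreadLossFew3` (through the medium systems; the direct restriction fails at
`k = 0`). -/
theorem spreadLossFew3_of_spreadLoss3 (h : SpreadDial.SpreadLoss3) : SpreadLossFew3 :=
  spreadLossFew3_of_linSpreadLogMed3 (linSpreadLogMed3_of_spreadLoss3 h)

/-- CodimDialFew helper `fewCover3_iff_linCoverLogMed3` (decomp-qadv land package; see the module docstring). -/
theorem fewCover3_iff_linCoverLogMed3 : FewCover3 ↔ LinCoverLogMed3 :=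
  ⟨fun h hP hA => linSpreadLogMed3_of_spreadLossFew3 (h hP hA),
    fun h hP hA => spreadLossFew3_of_linSpreadLogMed3 (h hP hA)⟩

/-- CodimDialFew helper `fewBridge3_iff_medBridge3` (decomp-qadv land package; see the module docstring). -/
theorem fewBridge3_iff_medBridge3 : FewBridge3 ↔ MedBridge3 :=
  ⟨fun h hM => h (spreadLossFew3_of_linSpreadLogMed3 hM), fun h hF => h (linSpreadLogMed3_of_spreadLossFew3 hF)⟩

/-- ★ **THE `m`-AXIS SPLIT OF 30910**: `PureCover3 ⟺ FewCover3 ∧ FewBridge3` — (30910 for polylog many rings) ∧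
(polylog many rings ⟹ polynomially many). -/
theorem pureCover3_iff_fewPieces : SpreadDial.PureCover3 ↔ (FewCover3 ∧ FewBridge3) := by
  rw [pureCover3_iff_medPieces, fewCover3_iff_linCoverLogMed3, fewBridge3_iff_medBridge3]

/-- 30910 ⟹ each piece; T ⟹ each piece. -/
theorem fewCover3_of_pureCover3 (h : SpreadDial.PureCover3) : FewCover3 := (pureCover3_iff_fewPieces.mp h).1

/-- CodimDialFew helper `fewBridge3_of_pureCover3` (decomp-qadv land package; see the module docstring). -/
theorem fewBridge3_of_pureCover3 (h : SpreadDial.PureCover3) : FewBridge3 := (pureCover3_iff_fewPieces.mp h).2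

/-- CodimDialFew helper `fewCover3_of_ringHardOdd` (decomp-qadv land package; see the module docstring). -/
theorem fewCover3_of_ringHardOdd (h : RingHardOdd 3) : FewCover3 :=
  fewCover3_iff_linCoverLogMed3.mpr (linCoverLogMed3_of_ringHardOdd h)

/-- CodimDialFew helper `fewBridge3_of_ringHardOdd` (decomp-qadv land package; see the module docstring). -/
theorem fewBridge3_of_ringHardOdd (h : RingHardOdd 3) : FewBridge3 :=
  fewBridge3_iff_medBridge3.mpr (medBridge3_of_ringHardOdd h)

/-- ★ **THE DECIDING THEOREM in the route's currency**:
`PolyLoss3 → AlgCover3 → FewCover3 → FewBridge3 → AdviceFreeQNC0Three`. -/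
theorem closes₅ (hP : SpreadDial.PolyLoss3) (hAlg : SpreadDial.AlgCover3) (hA : FewCover3) (hB : FewBridge3) :
    AdviceFreeQNC0Three :=
  closes₄ hP hAlg (fewCover3_iff_linCoverLogMed3.mp hA) (fewBridge3_iff_medBridge3.mp hB)

end Few

end Summit.QuantumAdvantage.QuantumAdvantage.Theorems.CodimDial
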